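import Literature.Analysis.FluidPDE.TypeIAncientMild
import Literature.Analysis.FluidPDE.KNSSTypeIRateLiouvilleHolds
import Summits.NavierStokesRegularity.NavierStokesRegularity.Theorems.SqueezeCycleExtremalElementExistsRescale
import HarnessLib

/-!
# `SymmetricLiouville` (crux stmt-NavierStokesRegularity-4053), line `blowdown-kills-pitch`,
# stub `stub_periodicBlowdownVanishing` (A1, the lever): blow-down kills the pitch

Support file (everything proved, kind = proof) for the lead's skeleton of the line
`blowdown-kills-pitch` (`Cruxes/SymmetricLiouville/Lines/blowdown-kills-pitch.lean`). Statement (verbatim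
the registered stub): given sequential compactness of the Type-I ancient mild class `A_C`
(`IsTypeIAncientMild C`, slice-wise locally uniform limits in the class — "F3", a hypothesis here, proved in
the skeleton from `Theorems.exists_tendsto_of_isTypeIAncientMild_seq`) and its covariance under linear
isometries (a hypothesis here, stub `stub_rotationCovariance`), every element of `A_C` which is periodic in
some direction `e ≠ 0` has scale-invariant size `√(−t)‖u(t, x)‖ → 0` as `t → −∞`, uniformly in `x`.

Proof (KNSS 2009 §6-type zoom-out; Koch–Nadirashvili–Seregin–Šverák, Acta Math. 203 (2009), proof of
Thm 6.2): rotate `e` onto the `x₂`-axis; if the conclusion fails pick `t_n < −(n+1)`, `x_n` with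
`√(−t_n)‖u(t_n, x_n)‖ > ε`; the blow-downs `v_n(s, y) = λ_n u(λ_n² s, x_n + λ_n y)`, `λ_n = √(−t_n)`, lie in
`A_C` (`Theorems.isTypeIAncientMild_zoom`), have `‖v_n(−1, 0)‖ > ε` and period `(ℓ/λ_n) e₂ → 0`; an F3-limit
`w ∈ A_C` has `‖w(−1, 0)‖ ≥ ε` and is invariant under the whole line `ℝ e₂` (integer multiples of the
shrinking periods approximate every real shift; locally uniform convergence + continuity); its time shift
`w(· − ½)` is a bounded `x₂`-independent ancient Oseen-mild field with the Type-I rate, hence `0` by the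
PROVED tree theorem `KNSS2009_typeI_rate_liouville_holds` (KNSS Thm 5.1 + Rem 6.1 + caloric Liouville) —
contradicting `w(−1, 0) ≠ 0`. [cite: KochNadirashviliSereginSverak2009, proof of Thm 6.2 (arXiv:0709.3599 p. 13)]
-/

noncomputable section

set_option linter.dupNamespace false

open Set Function Filter MeasureTheory
open scoped Topology

namespace Summit.NavierStokesRegularity.NavierStokesRegularity.Theorems.SymmetryModuliCountSymmetricLiouville

open Literature.Analysis Literature.Analysis.FluidPDE

/-- Local notation for physical space `ℝ³`. -/
local notation "E3" => EuclideanSpace ℝ (Fin 3)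

/-! ### Elementary helpers -/

/-- A function periodic under `x ↦ x + e` is periodic under every integer multiple of `e`. -/
theorem periodic_int_smul {F : Type*} {f : E3 → F} {e : E3} (h : ∀ x, f (x + e) = f x) (k : ℤ)
    (x : E3) : f (x + (k : ℝ) • e) = f x := by
  induction k using Int.induction_on generalizing x with
  | zero => simp
  | succ n ih =>
    have e1 : x + ((((n : ℤ) + 1 : ℤ) : ℝ)) • e = (x + ((n : ℤ) : ℝ) • e) + e := by
      push_cast
      rw [add_smul, one_smul, add_assoc]
    rw [e1, h, ih]
  | pred n ih =>
    have e1 : x + ((-(n : ℤ) - 1 : ℤ) : ℝ) • e + e = x + ((-(n : ℤ) : ℤ) : ℝ) • e := by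
      push_cast
      rw [sub_smul, one_smul]
      abel
    rw [← h, e1, ih]

/-- The unit vector `e₂` of the `x₂`-axis (Lean coordinate `1`). -/
theorem norm_single_one_one : ‖(EuclideanSpace.single (1 : Fin 3) (1 : ℝ) : E3)‖ = 1 := by
  simp

/-- `EuclideanSpace.single 1 δ = δ • e₂`. -/
theorem single_one_eq_smul (δ : ℝ) :
    (EuclideanSpace.single (1 : Fin 3) δ : E3) = δ • EuclideanSpace.single (1 : Fin 3) (1 : ℝ) := by
  ext i
  by_cases hi : i = 1
  · subst hi; simp
  · simp [hi]

/-- Every nonzero vector is carried onto the positive `x₂`-axis by a linear isometry (a reflection). -/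
theorem exists_linearIsometryEquiv_map_eq_smul_single (e : E3) :
    ∃ L : E3 ≃ₗᵢ[ℝ] E3, L e = ‖e‖ • EuclideanSpace.single (1 : Fin 3) (1 : ℝ) := by
  have hn : ‖e‖ = ‖(‖e‖ • EuclideanSpace.single (1 : Fin 3) (1 : ℝ) : E3)‖ := by
    rw [norm_smul, norm_single_one_one, mul_one, Real.norm_of_nonneg (norm_nonneg _)]
  exact ⟨_, Submodule.reflection_sub hn⟩

/-- `√(−t) · C/√(δ − t) ≤ C` for `t < 0 ≤ δ`, `0 ≤ C`: the Type-I rate survives backward time shifts. -/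
theorem sqrt_mul_div_sqrt_shift_le {C δ t : ℝ} (hC : 0 ≤ C) (hδ : 0 ≤ δ) (ht : t < 0) :
    Real.sqrt (-t) * (C / Real.sqrt (-(t - δ))) ≤ C := by
  have hs : 0 < Real.sqrt (-(t - δ)) := Real.sqrt_pos.2 (by linarith)
  have hle : Real.sqrt (-t) ≤ Real.sqrt (-(t - δ)) := Real.sqrt_le_sqrt (by linarith)
  rw [mul_div_assoc', div_le_iff₀ hs]
  calc Real.sqrt (-t) * C = C * Real.sqrt (-t) := mul_comm _ _
    _ ≤ C * Real.sqrt (-(t - δ)) := mul_le_mul_of_nonneg_left hle hC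

/-! ### The lever on the `x₂`-axis -/

/-- **Blow-down kills the pitch, axis version.** Given F3 at constant `C`, an element of `A_C` that is
periodic under the translation by `ℓ e₂`, `ℓ > 0`, has `√(−t)‖u(t, x)‖ → 0` as `t → −∞` uniformly in `x`
(module docstring for the proof). -/
theorem periodicBlowdownVanishing_axis {C ℓ : ℝ}
    (hF3 : ∀ v : ℕ → ℝ → E3 → E3, (∀ n, IsTypeIAncientMild C (v n)) →
      ∃ (φ : ℕ → ℕ) (w : ℝ → E3 → E3), StrictMono φ ∧ IsTypeIAncientMild C w ∧
        ∀ t < 0, TendstoLocallyUniformly (fun n => v (φ n) t) (w t) atTop)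
    {u : ℝ → E3 → E3} (hu : IsTypeIAncientMild C u) (hℓ : 0 < ℓ)
    (hper : ∀ t < 0, ∀ x, u t (x + ℓ • EuclideanSpace.single (1 : Fin 3) (1 : ℝ)) = u t x) :
    ∀ ε > 0, ∃ T < 0, ∀ t < T, ∀ x, Real.sqrt (-t) * ‖u t x‖ ≤ ε := by
  set e₂ : E3 := EuclideanSpace.single (1 : Fin 3) (1 : ℝ) with he₂
  intro ε hε
  by_contra hcon
  push Not at hcon
  -- violators `t_n < -(n+1)`, `x_n`
  have hch : ∀ n : ℕ, ∃ tx : ℝ × E3, tx.1 < -((n : ℝ) + 1) ∧ ε < Real.sqrt (-tx.1) * ‖u tx.1 tx.2‖ := by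
    intro n
    obtain ⟨t, ht, x, hx⟩ := hcon (-((n : ℝ) + 1)) (by linarith [(Nat.cast_nonneg n : (0 : ℝ) ≤ n)])
    exact ⟨(t, x), ht, hx⟩
  choose tx htx hbig using hch
  set tn : ℕ → ℝ := fun n => (tx n).1 with htn
  set xn : ℕ → E3 := fun n => (tx n).2 with hxn
  have htn_lt : ∀ n, tn n < -((n : ℝ) + 1) := fun n => htx n
  have htn_neg : ∀ n, tn n < 0 := fun n =>
    (htn_lt n).trans_le (by linarith [(Nat.cast_nonneg n : (0 : ℝ) ≤ n)])
  -- the scales `λ_n = √(-t_n)`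
  set lam : ℕ → ℝ := fun n => Real.sqrt (-(tn n)) with hlam
  have hlam0 : ∀ n, 0 < lam n := fun n => Real.sqrt_pos.2 (neg_pos.2 (htn_neg n))
  have hlam2 : ∀ n, lam n ^ 2 = -(tn n) := fun n => Real.sq_sqrt (neg_nonneg.2 (htn_neg n).le)
  have hlam_ge' : ∀ n : ℕ, Real.sqrt ((n : ℝ) + 1) ≤ lam n := fun n => by
    rw [hlam]; exact Real.sqrt_le_sqrt (by linarith [htn_lt n])
  -- the blow-downs
  set v : ℕ → ℝ → E3 → E3 := fun n => lam n • stPull (lam n ^ 2) (lam n) 0 (xn n) u with hv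
  have hvcl : ∀ n, IsTypeIAncientMild C (v n) := fun n => isTypeIAncientMild_zoom hu (hlam0 n) (xn n)
  have hv_apply : ∀ n s y, v n s y = lam n • u (lam n ^ 2 * s) (xn n + lam n • y) := fun n s y =>
    zoom_apply (lam n) (xn n) u s y
  -- nontrivial at the interior point `(-1, 0)`
  have hv1 : ∀ n, ε < ‖v n (-1) 0‖ := by
    intro n
    rw [hv_apply, smul_zero, add_zero, mul_neg_one, hlam2, neg_neg, norm_smul,
      Real.norm_of_nonneg (hlam0 n).le]
    exact hbig n
  -- periodic with the shrinking periods `(ℓ/λ_n) e₂`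
  have hvper : ∀ n, ∀ s < 0, ∀ (y : E3) (k : ℤ),
      v n s (y + ((k : ℝ) * (ℓ / lam n)) • e₂) = v n s y := by
    intro n s hs y k
    have hs' : lam n ^ 2 * s < 0 := mul_neg_of_pos_of_neg (pow_pos (hlam0 n) 2) hs
    rw [hv_apply, hv_apply, smul_add, smul_smul, ← add_assoc]
    have hc : lam n * ((k : ℝ) * (ℓ / lam n)) = (k : ℝ) * ℓ := by
      rw [mul_comm, mul_assoc, div_mul_cancel₀ _ (hlam0 n).ne']
    rw [hc, mul_smul]
    exact congrArg (fun z => lam n • z)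
      (periodic_int_smul (f := u (lam n ^ 2 * s)) (e := ℓ • e₂) (hper _ hs') k _)
  -- compactness: a limit `w ∈ A_C`
  obtain ⟨φ, w, hφ, hw, hloc⟩ := hF3 v hvcl
  have hφge : ∀ n, n ≤ φ n := fun n => hφ.id_le n
  have hwc : ∀ s < 0, Continuous (w s) := fun s hs => hw.continuous_slice hs
  have hpt : ∀ s < 0, ∀ y, Tendsto (fun n => v (φ n) s y) atTop (𝓝 (w s y)) := fun s hs y =>
    (hloc s hs).tendsto_comp (hwc s hs).continuousAt tendsto_const_nhds
  -- `‖w(-1, 0)‖ ≥ ε`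
  have hw1 : ε ≤ ‖w (-1) 0‖ :=
    ge_of_tendsto ((hpt (-1) (by norm_num) 0).norm) (Eventually.of_forall fun n => (hv1 (φ n)).le)
  -- `w` is invariant under the whole line `ℝ e₂`
  have hwinv : ∀ s < 0, ∀ (y : E3) (θ : ℝ), w s (y + θ • e₂) = w s y := by
    intro s hs y θ
    set p : ℕ → ℝ := fun n => ℓ / lam (φ n) with hp
    have hp0 : ∀ n, 0 < p n := fun n => div_pos hℓ (hlam0 _)
    -- `p n → 0`
    have hp_lim : Tendsto p atTop (𝓝 0) := by
      have h1 : Tendsto (fun n : ℕ => Real.sqrt ((n : ℝ) + 1)) atTop atTop :=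
        Real.tendsto_sqrt_atTop.comp (tendsto_natCast_atTop_atTop.atTop_add tendsto_const_nhds)
      have h2 : Tendsto (fun n => lam (φ n)) atTop atTop := by
        refine tendsto_atTop_mono (fun n => ?_) (h1.comp hφ.tendsto_atTop)
        exact hlam_ge' (φ n)
      have h3 := h2.inv_tendsto_atTop.const_mul ℓ
      rw [mul_zero] at h3
      refine h3.congr fun n => ?_
      simp only [hp, Pi.inv_apply, div_eq_mul_inv]
    -- integers `k_n` with `k_n p_n → θ`
    set k : ℕ → ℤ := fun n => ⌊θ / p n⌋ with hk
    have hk_lim : Tendsto (fun n => (k n : ℝ) * p n) atTop (𝓝 θ) := by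
      have hlow : ∀ n, θ - p n ≤ (k n : ℝ) * p n := fun n => by
        have h := Int.lt_floor_add_one (θ / p n)
        have : θ < ((k n : ℝ) + 1) * p n := by
          rw [← div_lt_iff₀ (hp0 n)]; exact h
        linarith [this]
      have hup : ∀ n, (k n : ℝ) * p n ≤ θ := fun n => by
        rw [← le_div_iff₀ (hp0 n)]; exact Int.floor_le _
      have hl : Tendsto (fun n => θ - p n) atTop (𝓝 θ) := by
        simpa using (tendsto_const_nhds (x := θ)).sub hp_lim
      exact tendsto_of_tendsto_of_tendsto_of_le_of_le hl tendsto_const_nhds hlow hup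
    have hg : Tendsto (fun n => y + ((k n : ℝ) * p n) • e₂) atTop (𝓝 (y + θ • e₂)) :=
      tendsto_const_nhds.add (hk_lim.smul_const e₂)
    have h1 : Tendsto (fun n => v (φ n) s (y + ((k n : ℝ) * p n) • e₂)) atTop (𝓝 (w s (y + θ • e₂))) :=
      (hloc s hs).tendsto_comp (hwc s hs).continuousAt hg
    have heq : (fun n => v (φ n) s (y + ((k n : ℝ) * p n) • e₂)) = fun n => v (φ n) s y :=
      funext fun n => hvper (φ n) s hs y (k n)
    rw [heq] at h1
    exact tendsto_nhds_unique h1 (hpt s hs y)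
  -- the time shift `W = w(· - 1/2)` is a bounded `x₂`-independent ancient mild field with the rate
  set W : ℝ → E3 → E3 := fun t => w (t - 1 / 2) with hW
  have hWcl : IsTypeIAncientMild C W := hw.comp_sub_right (by norm_num : (0 : ℝ) ≤ 1 / 2)
  have hC : 0 ≤ C := hw.nonneg
  have hWb : ∃ K : ℝ, ∀ t < 0, ∀ x, ‖W t x‖ ≤ K := by
    refine ⟨C / Real.sqrt (1 / 2), fun t ht x => (hw.norm_le (t := t - 1 / 2) (by linarith) x).trans ?_⟩
    exact div_le_div_of_nonneg_left hC (Real.sqrt_pos.2 (by norm_num)) (Real.sqrt_le_sqrt (by linarith))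
  have hWi : ∀ t < 0, ∀ (x : E3) (δ : ℝ), W t (x + EuclideanSpace.single (1 : Fin 3) δ) = W t x := by
    intro t ht x δ
    rw [single_one_eq_smul]
    exact hwinv (t - 1 / 2) (by linarith) x δ
  have hWr : ∀ t < 0, ∀ x, Real.sqrt (-t) * ‖W t x‖ ≤ C := by
    intro t ht x
    calc Real.sqrt (-t) * ‖W t x‖ ≤ Real.sqrt (-t) * (C / Real.sqrt (-(t - 1 / 2))) :=
          mul_le_mul_of_nonneg_left (hw.norm_le (by linarith) x) (Real.sqrt_nonneg _)
      _ ≤ C := sqrt_mul_div_sqrt_shift_le hC (by norm_num) ht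
  have hW0 : ∀ t < 0, ∀ x, W t x = 0 :=
    KNSS2009_typeI_rate_liouville_holds hWcl.continuousOn_uncurry hWb
      (fun t ht => hWcl.isWeaklyDivFree ht) (fun s t hst ht x => hWcl.mild_eq_heatExtension hst ht x)
      hWi hWr
  -- contradiction at `(-1, 0)`
  have hzero : w (-1) 0 = 0 := by
    have h := hW0 (-1 / 2) (by norm_num) 0
    simp only [hW] at h
    norm_num at h
    exact h
  rw [hzero, norm_zero] at hw1
  exact absurd hw1 (not_le.2 hε)

/-! ### The registered stub -/

/-- **Stub A1 — blow-down kills the pitch** (verbatim the registered stub of line `blowdown-kills-pitch`):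
given F3 and rotation covariance of `A_C` at constant `C`, an element of `A_C` which is periodic in some
direction `e ≠ 0` has `√(−t)‖u(t, x)‖ → 0` as `t → −∞`, uniformly in `x`. Reduction to the axis version by
the isometry carrying `e` to `‖e‖ e₂` (`exists_linearIsometryEquiv_map_eq_smul_single`). [cite: KochNadirashviliSereginSverak2009, proof of Thm 6.2 (arXiv:0709.3599 p. 13)] -/
theorem stub_periodicBlowdownVanishing :
    ∀ C : ℝ,
      (∀ v : ℕ → ℝ → E3 → E3, (∀ n, IsTypeIAncientMild C (v n)) →
      ∃ (φ : ℕ → ℕ) (w : ℝ → E3 → E3), StrictMono φ ∧ IsTypeIAncientMild C w ∧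
        ∀ t < 0, TendstoLocallyUniformly (fun n => v (φ n) t) (w t) atTop) →
      (∀ (L : E3 ≃ₗᵢ[ℝ] E3) (u : ℝ → E3 → E3), IsTypeIAncientMild C u →
      IsTypeIAncientMild C (fun t x => L (u t (L.symm x)))) →
      ∀ u : ℝ → E3 → E3, IsTypeIAncientMild C u →
        ∀ e : E3, e ≠ 0 → (∀ t < 0, ∀ x, u t (x + e) = u t x) →
        ∀ ε > 0, ∃ T < 0, ∀ t < T, ∀ x, Real.sqrt (-t) * ‖u t x‖ ≤ ε := by
  intro C hF3 hRot u hu e he hper ε hε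
  obtain ⟨L, hL⟩ := exists_linearIsometryEquiv_map_eq_smul_single e
  -- the rotated field is in the class and periodic along the axis
  set U : ℝ → E3 → E3 := fun t x => L (u t (L.symm x)) with hU
  have hUcl : IsTypeIAncientMild C U := hRot L u hu
  have hUper : ∀ t < 0, ∀ x, U t (x + ‖e‖ • EuclideanSpace.single (1 : Fin 3) (1 : ℝ)) = U t x := by
    intro t ht x
    simp only [hU]
    rw [← hL, map_add, L.symm_apply_apply, hper t ht]
  obtain ⟨T, hT, hsmall⟩ :=
    periodicBlowdownVanishing_axis hF3 hUcl (norm_pos_iff.2 he) hUper ε hε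
  refine ⟨T, hT, fun t ht x => ?_⟩
  have h := hsmall t ht (L x)
  simp only [hU, L.symm_apply_apply, LinearIsometryEquiv.norm_map] at h
  exact h

end Summit.NavierStokesRegularity.NavierStokesRegularity.Theorems.SymmetryModuliCountSymmetricLiouville

end
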